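import Literature.NumberTheory.LFunctions.TaoLogElliottWindowTI
import Literature.NumberTheory.LFunctions.TaoLogElliottDiscretisation
import Literature.NumberTheory.LFunctions.TaoLogElliottEndgame
import Literature.NumberTheory.LFunctions.TaoLogElliottCircleMethod
import Literature.Probability.Entropy.EntropyOfWindows
import HarnessLib

/-!
# Tao's log-averaged Elliott theorem: the random variables `X_H`, `Y_H` of the entropy argument

Part of the proof DAG below the named fact `Literature.NumberTheory.LFunctions.Tao2016_theorem23_core` (Tao, Forum Math. Pi 4
(2016) e8, proof of Theorem 2.3).  The paper introduces (§2, after the proof of Proposition 2.6)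
the discretised functions `g_{i,ε²}` ("`gᵢ` rounded to the nearest element of the lattice
`ε² ℤ[i]`"), the random variable `X_H := (g_{i,ε²}(a𝐧 + j))_{i=1,2; j ∈ [1,H]}` and
`Y_H := 𝐧 mod P_H`, on the logarithmically weighted range `x/ω < n ≤ x`
(`Literature.NumberTheory.LFunctions.Tao2016.logSpace`, `Literature.NumberTheory.LFunctions.Tao2016.logWeight`).  This file fixes these objects in the form
in which the abstract entropy files (`EntropyOfWindows.lean`, `EntropyDecoupling.lean`,
`TaoEntropyDecrementInSitu.lean`, `TaoLogElliottWindowTI.lean`) consume them: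

* `roundTo δ g` — `g` rounded to the mesh `δ ℤ[i]` (`Literature.StatMech.meshPoint ∘ nearestSite`),
  with `|roundTo δ g - g| ≤ δ`, `|roundTo δ g| ≤ 1 + δ`, and values in the finite alphabet
  `meshAlphabet δ` of cardinality `≤ (2⌈1/δ⌉ + 3)²` ("takes `O_ε(1)` values");
* `pairRound δ g₁ g₂ m = (g_{1,δ}(m), g_{2,δ}(m))`, so that
  `X_H = window (process (pairRound δ g₁ g₂) a) 0 H` (`Literature.Probability.Entropy.FiniteShannon.window`,
  `Literature.NumberTheory.LFunctions.Tao2016.process`) is the list `((g_{1,δ}, g_{2,δ})(a𝐧 + j))_{j=1}^H`;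
* `lseq f l` — reading a coordinate of such a list back as a row `ℤ → ℂ` on `[1, H]`
  (`lseq_window`, `lseq_window_fst/snd`: it is the row `seqAt (roundTo δ gᵢ) (a𝐧)` of
  `TaoLogElliottEndgame.lean` on `[1, H]`);
* `window_eq_ofFn`, `windowSet V H` (all words of length `H` over an alphabet `V`, of
  cardinality `≤ #V^H`) and `window_mem_windowSet` — the finite ranges needed for the continuity
  estimates of `TaoLogElliottWindowTI.lean`;
* `prod_primesP_le_four_pow` — `P_H = ∏_{p ∈ 𝒫_H} p ≤ 4^{⌊ε²H⌋}` (so `𝐇(Y_H) ≤ log P_H ≪ H`,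
  display (3.10)).

## References
* T. Tao, Forum Math. Pi 4 (2016), e8; arXiv:1509.05422, §2 (after Proposition 2.6) and §3,
  (3.8), (3.10).
-/

open Finset Real Complex

namespace Literature.NumberTheory.LFunctions

namespace Tao2016

open Literature.Probability.LatticeModels Literature.Probability.Entropy.FiniteShannon

/-! ### The discretised functions `g_{δ}` -/

/-- `g_δ`: `g` rounded to the nearest element of the lattice `δ ℤ[i]` (Tao 2016, §2: `g_{i,ε²}`
with `δ = ε²`). [cite: TaoFMP2016, §2 (paragraph after the proof of Proposition 2.6)] -/
noncomputable def roundTo (δ : ℝ) (g : ℕ → ℂ) : ℕ → ℂ := fun n => meshPoint δ (nearestSite δ (g n))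

/-- Unfolding `roundTo`. [folklore] -/
theorem roundTo_apply (δ : ℝ) (g : ℕ → ℂ) (n : ℕ) :
    roundTo δ g n = meshPoint δ (nearestSite δ (g n)) := rfl

/-- `g_δ = g + O(δ)`. [cite: TaoFMP2016, §2 (paragraph after the proof of Proposition 2.6)] -/
theorem norm_roundTo_sub_le {δ : ℝ} (hδ : 0 < δ) (g : ℕ → ℂ) (n : ℕ) :
    ‖roundTo δ g n - g n‖ ≤ δ := by
  have h1 := dist_meshPoint_nearestSite_le hδ (g n)
  rwa [Complex.dist_eq] at h1

/-- `|g_δ| ≤ 1 + δ` when `|g| ≤ 1`. [cite: TaoFMP2016, §2 (paragraph after the proof of Proposition 2.6)] -/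
theorem norm_roundTo_le {δ : ℝ} (hδ : 0 < δ) {g : ℕ → ℂ} {n : ℕ} (hg : ‖g n‖ ≤ 1) :
    ‖roundTo δ g n‖ ≤ 1 + δ :=
  (norm_meshPoint_nearestSite_le hδ _).trans (by linarith)

/-- The finite alphabet of `g_δ`: the mesh points of the box `[-K, K]²`, `K = ⌈1/δ⌉ + 1`.
[cite: TaoFMP2016, §2 (paragraph after the proof of Proposition 2.6: "takes at most O_ε(1) values")] -/
noncomputable def meshAlphabet (δ : ℝ) : Finset ℂ := (box 2 (⌈1 / δ⌉₊ + 1)).image (meshPoint δ)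

/-- `g_δ(n)` lies in the alphabet when `|g(n)| ≤ 1`. [folklore] -/
theorem roundTo_mem_meshAlphabet {δ : ℝ} (hδ : 0 < δ) {g : ℕ → ℂ} {n : ℕ} (hg : ‖g n‖ ≤ 1) :
    roundTo δ g n ∈ meshAlphabet δ :=
  mem_image_of_mem _ (nearestSite_mem_box hδ hg)

/-- `#alphabet ≤ (2K + 1)²`, `K = ⌈1/δ⌉ + 1`. [folklore] -/
theorem card_meshAlphabet_le (δ : ℝ) : #(meshAlphabet δ) ≤ (2 * (⌈1 / δ⌉₊ + 1) + 1) ^ 2 := by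
  unfold meshAlphabet
  exact card_image_le.trans (card_box 2 _).le

/-- The pair `(g_{1,δ}(m), g_{2,δ}(m))`: the coordinate process whose windows along `a𝐧 + [1, H]`
form `X_H` (Tao 2016, §2, definition of `X_H`). [cite: TaoFMP2016, §2 (definition of X_H before Remark 2.7)] -/
noncomputable def pairRound (δ : ℝ) (g₁ g₂ : ℕ → ℂ) : ℕ → ℂ × ℂ :=
  fun m => (roundTo δ g₁ m, roundTo δ g₂ m)

/-- The coordinates of the pair process lie in `alphabet × alphabet`. [folklore] -/
theorem pairRound_mem {δ : ℝ} (hδ : 0 < δ) {g₁ g₂ : ℕ → ℂ} (hb₁ : ∀ n, ‖g₁ n‖ ≤ 1)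
    (hb₂ : ∀ n, ‖g₂ n‖ ≤ 1) (m : ℕ) :
    pairRound δ g₁ g₂ m ∈ meshAlphabet δ ×ˢ meshAlphabet δ :=
  mem_product.2 ⟨roundTo_mem_meshAlphabet hδ (hb₁ m), roundTo_mem_meshAlphabet hδ (hb₂ m)⟩

/-! ### Windows as words: entries and the finite range -/

section Windows

variable {ι α : Type*}

/-- A window is the word of its entries: `X_{m,m+H}(i) = (W_{m+1}(i), …, W_{m+H}(i))`.
[folklore] -/
theorem window_eq_ofFn (W : ℕ → ι → α) (m : ℕ) (i : ι) (H : ℕ) :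
    window W m H i = List.ofFn (fun k : Fin H => W (m + k + 1) i) := by
  induction H with
  | zero => rfl
  | succ H ih =>
      rw [window_succ, ih, List.ofFn_succ', List.concat_eq_append]
      rfl

/-- The `k`-th entry (0-based) of the window is `W_{m+k+1}`. [folklore] -/
theorem getElem?_window (W : ℕ → ι → α) (m : ℕ) (i : ι) {H k : ℕ} (hk : k < H) :
    (window W m H i)[k]? = some (W (m + k + 1) i) := by
  rw [window_eq_ofFn, List.getElem?_ofFn]
  simp [hk]

/-- Entries of a window are values of the process. [folklore] -/
theorem mem_window_iff (W : ℕ → ι → α) (m : ℕ) (i : ι) (H : ℕ) (v : α) :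
    v ∈ window W m H i ↔ ∃ k : ℕ, k < H ∧ W (m + k + 1) i = v := by
  rw [window_eq_ofFn, List.mem_ofFn]
  constructor
  · rintro ⟨k, hk⟩; exact ⟨k, k.2, hk⟩
  · rintro ⟨k, hk, hv⟩; exact ⟨⟨k, hk⟩, hv⟩

/-- All words of length `H` over the alphabet `V`. [folklore] -/
noncomputable def windowSet [DecidableEq α] (V : Finset α) (H : ℕ) : Finset (List α) :=
  (univ : Finset (Fin H → V)).image fun f => List.ofFn fun k => (f k : α)

/-- `#(words of length H over V) ≤ #V^H`. [folklore] -/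
theorem card_windowSet_le [DecidableEq α] (V : Finset α) (H : ℕ) : #(windowSet V H) ≤ #V ^ H := by
  unfold windowSet
  refine card_image_le.trans ?_
  rw [card_univ, Fintype.card_pi, prod_const, card_univ, Fintype.card_coe, Fintype.card_fin]

/-- A window whose entries lie in `V` is a word over `V`. [folklore] -/
theorem window_mem_windowSet [DecidableEq α] {V : Finset α} {W : ℕ → ι → α} {m H : ℕ} {i : ι}
    (hW : ∀ k : ℕ, k < H → W (m + k + 1) i ∈ V) : window W m H i ∈ windowSet V H := by
  unfold windowSet
  rw [mem_image]
  refine ⟨fun k => ⟨W (m + k + 1) i, hW k k.2⟩, mem_univ _, ?_⟩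
  rw [window_eq_ofFn]

/-- Words over `V` have entries in `V`. [folklore] -/
theorem mem_of_mem_windowSet [DecidableEq α] {V : Finset α} {H : ℕ} {l : List α}
    (hl : l ∈ windowSet V H) : ∀ v ∈ l, v ∈ V := by
  unfold windowSet at hl
  obtain ⟨f, -, rfl⟩ := mem_image.1 hl
  intro v hv
  obtain ⟨k, rfl⟩ := List.mem_ofFn.1 hv
  exact (f k).2

/-- Words in `windowSet V H` have length `H`. [folklore] -/
theorem length_of_mem_windowSet [DecidableEq α] {V : Finset α} {H : ℕ} {l : List α}
    (hl : l ∈ windowSet V H) : l.length = H := by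
  unfold windowSet at hl
  obtain ⟨f, -, rfl⟩ := mem_image.1 hl
  exact List.length_ofFn

end Windows

/-! ### Reading a word back as a pair of rows on `[1, H]` -/

/-- The row `j ↦ f(l_j)` (`1 ≤ j ≤ |l|`, zero elsewhere) of a word `l` of pairs; with
`f = Prod.fst, Prod.snd` and `l = X_H(𝐧)` these are the rows `x_{i,j}(𝐧) = g_{i,δ}(a𝐧 + j)` of the
paper. [cite: TaoFMP2016, §2 (definition of X_H before Remark 2.7)] -/
noncomputable def lseq (f : ℂ × ℂ → ℂ) (l : List (ℂ × ℂ)) : ℤ → ℂ := fun j =>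
  if 1 ≤ j ∧ j ≤ l.length then f ((l[j.toNat - 1]?).getD 0) else 0

/-- `lseq` of a window: `lseq f (X_{0,H}(i)) j = f (W_j(i))` for `1 ≤ j ≤ H`. [folklore] -/
theorem lseq_window {ι : Type*} (f : ℂ × ℂ → ℂ) (W : ℕ → ι → ℂ × ℂ) (i : ι) {H : ℕ} {j : ℤ}
    (hj : j ∈ Icc (1 : ℤ) H) : lseq f (window W 0 H i) j = f (W j.toNat i) := by
  rw [mem_Icc] at hj
  unfold lseq
  rw [length_window, if_pos ⟨hj.1, hj.2⟩]
  have hk : j.toNat - 1 < H := by omega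
  rw [getElem?_window W 0 i hk, Option.getD_some]
  congr 2
  omega

/-- `lseq` vanishes off `[1, |l|]`, and on it is a value of `f` at an entry of `l`; hence it is
bounded by any bound for `f` on the entries (and by `0 ≤ B`). [folklore] -/
theorem norm_lseq_le {f : ℂ × ℂ → ℂ} {l : List (ℂ × ℂ)} {B : ℝ} (hB : 0 ≤ B)
    (hf : ∀ v ∈ l, ‖f v‖ ≤ B) (j : ℤ) : ‖lseq f l j‖ ≤ B := by
  unfold lseq
  split_ifs with hj
  · have hk : j.toNat - 1 < l.length := by omega
    rw [List.getElem?_eq_getElem hk, Option.getD_some]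
    exact hf _ (List.getElem_mem hk)
  · rwa [norm_zero]

/-- **The first row of `X_H(𝐧)` is `(g_{1,δ}(a𝐧 + j))_{j ∈ [1,H]}`**:
`lseq fst (X_H(n)) = seqAt (roundTo δ g₁) (a n)` on `[1, H]`. [cite: TaoFMP2016, §2 (definition of X_H before Remark 2.7)] -/
theorem lseq_window_fst (δ : ℝ) (g₁ g₂ : ℕ → ℂ) (a H n : ℕ) :
    ∀ j ∈ Icc (1 : ℤ) H, lseq Prod.fst (window (process (pairRound δ g₁ g₂) a) 0 H n) j =
      seqAt (roundTo δ g₁) (a * n) j := by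
  intro j hj
  rw [lseq_window _ _ _ hj]
  unfold process pairRound seqAt
  simp only
  congr 1
  have := (mem_Icc.1 hj).1
  omega

/-- **The second row of `X_H(𝐧)` is `(g_{2,δ}(a𝐧 + j))_{j ∈ [1,H]}`**. [cite: TaoFMP2016, §2 (definition of X_H before Remark 2.7)] -/
theorem lseq_window_snd (δ : ℝ) (g₁ g₂ : ℕ → ℂ) (a H n : ℕ) :
    ∀ j ∈ Icc (1 : ℤ) H, lseq Prod.snd (window (process (pairRound δ g₁ g₂) a) 0 H n) j =
      seqAt (roundTo δ g₂) (a * n) j := by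
  intro j hj
  rw [lseq_window _ _ _ hj]
  unfold process pairRound seqAt
  simp only
  congr 1
  have := (mem_Icc.1 hj).1
  omega

/-- The windows `X_H(𝐧)` are words over `alphabet²` (for `|gᵢ| ≤ 1`). [folklore] -/
theorem window_process_pairRound_mem {δ : ℝ} (hδ : 0 < δ) {g₁ g₂ : ℕ → ℂ} (hb₁ : ∀ n, ‖g₁ n‖ ≤ 1)
    (hb₂ : ∀ n, ‖g₂ n‖ ≤ 1) (a m H n : ℕ) :
    window (process (pairRound δ g₁ g₂) a) m H n ∈
      windowSet (meshAlphabet δ ×ˢ meshAlphabet δ) H :=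
  window_mem_windowSet fun _ _ => pairRound_mem hδ hb₁ hb₂ _

/-- Entries of words over `alphabet²` read through `fst`/`snd` composed with the rows: if every
entry `v` of `l` has `‖v.1‖, ‖v.2‖ ≤ 1 + δ` then the rows are `(1 + δ)`-bounded.  For words in the
range of `X_H` this is `|g_{i,δ}| ≤ 1 + δ`. [folklore] -/
theorem norm_lseq_window_le {δ : ℝ} (hδ : 0 < δ) {g₁ g₂ : ℕ → ℂ} (hb₁ : ∀ n, ‖g₁ n‖ ≤ 1)
    (hb₂ : ∀ n, ‖g₂ n‖ ≤ 1) (a H n : ℕ) (j : ℤ) :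
    ‖lseq Prod.fst (window (process (pairRound δ g₁ g₂) a) 0 H n) j‖ ≤ 1 + δ ∧
      ‖lseq Prod.snd (window (process (pairRound δ g₁ g₂) a) 0 H n) j‖ ≤ 1 + δ := by
  have hB : 0 ≤ 1 + δ := by linarith
  have hmem : ∀ v ∈ window (process (pairRound δ g₁ g₂) a) 0 H n,
      ‖v.1‖ ≤ 1 + δ ∧ ‖v.2‖ ≤ 1 + δ := by
    intro v hv
    obtain ⟨k, -, rfl⟩ := (mem_window_iff _ _ _ _ _).1 hv
    exact ⟨norm_roundTo_le hδ (hb₁ _), norm_roundTo_le hδ (hb₂ _)⟩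
  exact ⟨norm_lseq_le hB (fun v hv => (hmem v hv).1) j, norm_lseq_le hB (fun v hv => (hmem v hv).2) j⟩

/-! ### `P_H ≤ 4^{ε² H}` -/

/-- `P_H = ∏_{p ∈ 𝒫_H} p ≤ 4^{⌊ε² H⌋}` (the primorial bound), whence `log P_H ≤ (log 4) ε² H` and
(3.10): `𝐇(Y_H) ≤ log P_H ≪ H`. [cite: TaoFMP2016, §3 (3.10)] -/
theorem prod_primesP_le_four_pow (ε : ℝ) (H : ℕ) :
    ∏ p ∈ primesP ε H, p ≤ 4 ^ ⌊ε ^ 2 * H⌋₊ := by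
  refine le_trans ?_ (primorial_le_four_pow ⌊ε ^ 2 * H⌋₊)
  unfold primorial
  refine prod_le_prod_of_subset_of_one_le' (fun p hp => ?_) (fun _ hp _ => ?_)
  · unfold primesP at hp
    rw [mem_filter, Nat.mem_primesLE] at hp
    rw [mem_filter, mem_range]
    exact ⟨Nat.lt_succ_of_le hp.1.1, hp.1.2⟩
  · exact (mem_filter.1 hp).2.one_lt.le

/-- `0 < P_H`. [folklore] -/
theorem prod_primesP_pos (ε : ℝ) (H : ℕ) : 0 < ∏ p ∈ primesP ε H, p :=
  prod_pos fun _ hp => (prime_of_mem_primesP hp).pos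

end Tao2016

end Literature.NumberTheory.LFunctions
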